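import Mathlib.FieldTheory.Galois.Profinite
import Literature.AlgebraicGeometry.Frobenioids.PadicFrobenioidCZeroGalois
import Literature.AlgebraicGeometry.Frobenioids.PadicFrobenioidThm12Slim
import Literature.AnabelianGeometry.SemiGraphs.CosetCategoriesSlim
import HarnessLib

/-!
# Frobenioids II, Example 1.1 (i): `D₀` IS a slim category and `C₀` IS slim (Theorem 1.2 (iv) at `D₀`)

Mochizuki, *The geometry of Frobenioids II*, Kyushu J. Math. **62** (2008) 401–460, §1 Example 1.1 (i), p. 7
[cite: MochizukiFrdII2008, Ex 1.1 (i) p.7]: "a [model] Frobenioid `C₀` … over a slim base category `D₀`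
[cf. [AbsAnab], Theorem 1.1.1, (ii); [FrdI], Theorem 6.2, (iv); [FrdI], Theorem 6.4, (i)]", and Theorem 1.2 (iv),
p. 9 [cite: MochizukiFrdII2008, Thm 1.2 (iv) p.9]: "If `D` is slim, and `Λ ∈ {ℤ, ℝ}`, then `C` is also slim."

PROOF-ONLY (no definitions), closing both sentences AT THE PRINTED BASE `D₀ = 𝓑(G_{ℚ_p})⁰` (the small model
`PadicFrd.DZero p = CosetCat G_{ℚ_p}` of `PadicFrobenioidCZeroGalois.lean`):

* `PadicFrd.galQp_openSubgroups_separate` — the open subgroups of `G_{ℚ_p}` (Krull topology) separate points: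
  `σ ≠ 1` moves some `x ∈ ℚ̄_p`, and the fixing subgroup of `ℚ_p(x)` is open and misses `σ`;
* `PadicFrd.dZero_isSlim : IsSlim (DZero p)` — **"slim base category `D₀`"**: `G_{ℚ_p}` is compact (profinite,
  Mathlib), slim (abc-iut-L4-d2's PROVED [pGC] Lem. 15.8 at `ℚ_p`, `galQp_isSlimGroup`) and its open subgroups
  separate points, so `CosetCat G_{ℚ_p}` is slim by `CosetCat.isSlim_of_isSlimGroup` (`CosetCategoriesSlim.lean`);
* `PadicFrd.czeroGal_isSlim : IsSlim (CZeroGal p)` — **Theorem 1.2 (iv) for `C₀` itself, UNCONDITIONAL**: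
  abc-iut-L1-d8's `PadicFrd.Datum.thm12_iv_of_isMonoidData` (slim base ⇒ slim `p`-adic Frobenioid) at the datum
  `Datum.zeroGal p`, both of whose premises (`IsMonoidData`, `IsSlim D₀`) are now theorems.

Nothing of [FrdI]/[FrdII] is re-typed; no statement is strengthened; nothing here bears on [IUTchIII].
-/

namespace Literature.AlgebraicGeometry.Frobenioids

namespace PadicFrd

open CategoryTheory Literature.AnabelianGeometry.SemiGraphs QuasiTemperoid

variable (p : ℕ) [Fact p.Prime]

/-- The open subgroups of `G_{ℚ_p} = Gal(ℚ̄_p/ℚ_p)` (Krull topology) separate points: for `σ ≠ 1` there is an open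
subgroup not containing `σ` — the fixing subgroup of `ℚ_p(x)` for any `x` moved by `σ`.
[cite: MochizukiFrdII2008, Ex 1.1 (i) p.7] -/
theorem galQp_openSubgroups_separate (σ : GalFbar ℚ_[p]) (hσ : σ ≠ 1) :
    ∃ W : OpenSubgroup (GalFbar ℚ_[p]), σ ∉ (W : Set (GalFbar ℚ_[p])) := by
  -- some `x ∈ ℚ̄_p` is moved by `σ`
  have hx : ∃ x : Fbar ℚ_[p], σ x ≠ x := by
    by_contra h
    push Not at h
    exact hσ (AlgEquiv.ext h)
  obtain ⟨x, hx⟩ := hx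
  let E : IntermediateField ℚ_[p] (Fbar ℚ_[p]) := IntermediateField.adjoin ℚ_[p] {x}
  haveI : FiniteDimensional ℚ_[p] E :=
    IntermediateField.adjoin.finiteDimensional (Algebra.IsIntegral.isIntegral x)
  refine ⟨⟨E.fixingSubgroup, E.fixingSubgroup_isOpen⟩, fun hmem => hx ?_⟩
  have hmem' : σ ∈ E.fixingSubgroup := hmem
  rw [IntermediateField.mem_fixingSubgroup_iff] at hmem'
  exact hmem' x (IntermediateField.mem_adjoin_simple_self ℚ_[p] x)

/-- **"over a slim base category `D₀`"** (FrdII Ex. 1.1 (i), p. 7; [FrdI] §0 p. 14): `D₀ = 𝓑(G_{ℚ_p})⁰` (small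
model `CosetCat G_{ℚ_p}`) IS a slim category — `G_{ℚ_p}` is compact, slim ([AbsAnab] Thm. 1.1.1 (ii) /
[pGC] Lem. 15.8, abc-iut-L4-d2, `galQp_isSlimGroup`) and its open subgroups separate points
(`galQp_openSubgroups_separate`), so `CosetCat.isSlim_of_isSlimGroup` applies. [cite: MochizukiFrdII2008, Ex 1.1 (i) p.7] -/
theorem dZero_isSlim : IsSlim (DZero p) :=
  CosetCat.isSlim_of_isSlimGroup (galQp_openSubgroups_separate p) (galQp_isSlimGroup p)

/-- **Theorem 1.2 (iv) for `C₀` over `D₀`, UNCONDITIONAL** (FrdII p. 9: "If `D` is slim, and `Λ ∈ {ℤ, ℝ}`, then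
`C` is also slim"; `Λ = ℤ`): the `p`-adic Frobenioid `C₀` over the printed base `D₀` IS slim — abc-iut-L1-d8's
`Datum.thm12_iv_of_isMonoidData` at `Datum.zeroGal p` with `zeroGal_isMonoidData` and `dZero_isSlim`.
[cite: MochizukiFrdII2008, Thm 1.2 (iv) p.9] -/
theorem czeroGal_isSlim : IsSlim (CZeroGal p) :=
  (Datum.zeroGal p).thm12_iv_of_isMonoidData (zeroGal_isMonoidData p) (dZero_isSlim p)

end PadicFrd

end Literature.AlgebraicGeometry.Frobenioids
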